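import Summits.HubbardSuperconductivity.HubbardSuperconductivity.Theorems.AnisotropyChordTransferFibre3KernelHarmonicity
import Summits.HubbardSuperconductivity.HubbardSuperconductivity.Theorems.AnisotropyChordTransferFibre3ShellMajorant
import Summits.HubbardSuperconductivity.HubbardSuperconductivity.Theorems.AnisotropyChordTransferFibre3RowDecomposition

/-!
# Route `AnisotropyChord` / H0 rotor rung: lemmas for the first-difference estimate of the torus kernel symbol (centred representatives, Jordan in `ℓ¹` form, the abstract quotient estimate)

Third file of the periodisation toolkit (memo ROTOR-THEORY-21 §320–§322; after `…Fibre3Subsample`, `…Fibre3DyadicStep`).  The dyadic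
step reduced `|a_M − a_{2M}|` to the first-difference functional of `h_r(n) = (1 − cos k_n·r)/(2ε(k_n))` along a lattice direction.
This file collects the elementary pieces, all in the integer coordinates `m = (valMinAbs n₁, valMinAbs n₂)` of a momentum and
`r = (x, y) ∈ ℤ²`:
* `abs_cos_sub_cos_le_mul` (`|cos a − cos b| ≤ |a+b||a−b|/2`), `cos_theta_congr` (`cos(θA)` depends on `A mod N`),
  `re_phase_rep` (`Re φ_n(r) = cos(θ(m₁x + m₂y))`);
* `abs_div_sub_div_le`, ★ `quotient_diff_bound` — the abstract estimate `|u'/v' − u/v| ≤ (1/c + 1/c²)·ρ(a+½)/a'²` from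
  `u ≤ Ta²ρ/2`, `|Δu| ≤ Tρ(a+½)`, `v ≥ cTa²`, `v' ≥ cTa'²`, `|Δv| ≤ T(2a+1)`;
* `l1` (`= |m₁| + |m₂|`), `one_le_l1`, `two_epsT_ge_l1` (JORDAN: `2ε(n) ≥ (2/π²)θ²·l1(n)²`, from p2 g0's `jordanEpsLower_holds`),
  `dot_sq_le` (`A² ≤ l1²ρ`), `dot_mul_le` (`|A||x| + x²/2 ≤ (l1 + ½)ρ`);
* `rep_succ_congr`, `l1_succ_le` — the representative of `n + eₓ` (`ℓ¹` norms differ by at most one).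
Prover seat `hubbard-h0-rotor-p2` g2; helper for stmt-HubbardSuperconductivity-19089 (`--supports`, helper class).
WHAT THIS IS NOT: nothing here proves superconductivity in the Hubbard model; the rotor TARGET as originally worded stays
FALSE (g15 verdict).  Elementary estimates serving ONE analytic input (periodisation) of ONE input (HOLE₂) of ONE conditional
reduction (rung 19089); constants are crude (structural, not numerically useful).  Mathlib + tree imports only; no sorry, no axioms.
-/

set_option linter.dupNamespace false

noncomputable section

open scoped BigOperators
open Complex Finset

namespace Summit.HubbardSuperconductivity.HubbardSuperconductivity.Theorems.AnisotropyChord.Transfer.Fibre3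

namespace Subsample

variable (N : ℕ) [NeZero N]

/-! ## Elementary inequalities -/

omit [NeZero N] in
/-- `|cos a − cos b| ≤ |a + b|·|a − b|/2`. [folklore] -/
theorem abs_cos_sub_cos_le_mul (a b : ℝ) : |Real.cos a - Real.cos b| ≤ |a + b| * |a - b| / 2 := by
  rw [Real.cos_sub_cos, abs_mul, abs_mul, abs_neg, abs_two]
  have h1 := Real.abs_sin_le_abs (x := (a + b) / 2)
  have h2 := Real.abs_sin_le_abs (x := (a - b) / 2)
  rw [abs_div, abs_two] at h1 h2
  have := mul_le_mul h1 h2 (abs_nonneg _) (by positivity)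
  nlinarith [abs_nonneg (Real.sin ((a + b) / 2)), abs_nonneg (Real.sin ((a - b) / 2))]

/-- `cos(θ·A)` only depends on `A mod N` (`θ = 2π/N`). [folklore] -/
theorem cos_theta_congr {A B : ℤ} (h : ((A : ℤ) : ZMod N) = ((B : ℤ) : ZMod N)) :
    Real.cos (2 * Real.pi / N * A) = Real.cos (2 * Real.pi / N * B) := by
  rw [ZMod.intCast_eq_intCast_iff_dvd_sub] at h
  obtain ⟨t, ht⟩ := h
  have hN : (N : ℝ) ≠ 0 := by exact_mod_cast (NeZero.ne N)
  have : (2 * Real.pi / N * B : ℝ) = 2 * Real.pi / N * A + t * (2 * Real.pi) := by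
    have hB : (B : ℝ) = A + N * t := by
      have := congrArg (fun z : ℤ => (z : ℝ)) ht
      push_cast at this
      linarith
    rw [hB]
    field_simp
  rw [this, Real.cos_add_int_mul_two_pi]

/-! ## The symbol `h_r(n) = g(n)(1 − Re φ_n(r))` in integer coordinates -/

/-- `Re φ_n(r) = cos(θ (m₁x + m₂y))` with the centred representatives `m = (valMinAbs n₁, valMinAbs n₂)` and integer coordinates
`r = (x, y)`. [folklore] -/
theorem re_phase_rep (n : Tor N) (x y : ℤ) :
    (phase N n (((x : ℤ) : ZMod N), ((y : ℤ) : ZMod N))).re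
      = Real.cos (2 * Real.pi / N * ((n.1.valMinAbs * x + n.2.valMinAbs * y : ℤ) : ℝ)) := by
  rw [RateLemma.phase_re]
  have hcast : (((n.1.val * (((x : ℤ) : ZMod N)).val + n.2.val * (((y : ℤ) : ZMod N)).val : ℕ) : ℤ) : ZMod N)
      = (((n.1.valMinAbs * x + n.2.valMinAbs * y : ℤ)) : ZMod N) := by
    push_cast
    simp
  have h := cos_theta_congr N hcast
  rw [show (2 * Real.pi * (((n.1.val * (((x : ℤ) : ZMod N)).val + n.2.val * (((y : ℤ) : ZMod N)).val : ℕ)) : ℝ) / N)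
      = 2 * Real.pi / N * (((n.1.val * (((x : ℤ) : ZMod N)).val + n.2.val * (((y : ℤ) : ZMod N)).val : ℕ) : ℤ) : ℝ)
      by push_cast; ring]
  exact h

/-! ## The abstract quotient estimate -/

omit [NeZero N] in
/-- quotient differences: `|u'/v' − u/v| ≤ |u' − u|/v' + u·|v − v'|/(v v')` for `u ≥ 0`, `v, v' > 0`. [folklore] -/
theorem abs_div_sub_div_le {u u' v v' : ℝ} (hu : 0 ≤ u) (hv : 0 < v) (hv' : 0 < v') :
    |u' / v' - u / v| ≤ |u' - u| / v' + u * |v - v'| / (v * v') := by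
  have key : u' / v' - u / v = (u' - u) / v' + u * (v - v') / (v * v') := by
    field_simp
    ring
  rw [key]
  refine (abs_add_le _ _).trans ?_
  rw [abs_div, abs_of_pos hv', abs_div, abs_mul, abs_of_nonneg hu, abs_of_pos (mul_pos hv hv')]

omit [NeZero N] in
/-- ★ the abstract first-difference estimate: with `0 ≤ u ≤ T a² ρ/2`, `|u' − u| ≤ T ρ (a + ½)`, `v ≥ c T a²`, `v' ≥ c T a'²`,
`|v − v'| ≤ T(2a + 1)` (`T = θ²`, `c = 2/π²`, `a, a' ≥ 1`), one has `|u'/v' − u/v| ≤ (1/c + 1/c²)·ρ(a + ½)/a'²`. [folklore] -/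
theorem quotient_diff_bound {u u' v v' T c a a' ρ : ℝ} (hT : 0 < T) (hc : 0 < c) (ha : 1 ≤ a) (ha' : 1 ≤ a') (hρ : 0 ≤ ρ)
    (hu0 : 0 ≤ u) (hu : u ≤ T * a ^ 2 * ρ / 2) (hdu : |u' - u| ≤ T * ρ * (a + 1 / 2))
    (hv : c * T * a ^ 2 ≤ v) (hv' : c * T * a' ^ 2 ≤ v') (hdv : |v - v'| ≤ T * (2 * a + 1)) :
    |u' / v' - u / v| ≤ (1 / c + 1 / c ^ 2) * (ρ * (a + 1 / 2) / a' ^ 2) := by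
  have hvpos : 0 < v := lt_of_lt_of_le (by positivity) hv
  have hv'pos : 0 < v' := lt_of_lt_of_le (by positivity) hv'
  refine (abs_div_sub_div_le hu0 hvpos hv'pos).trans ?_
  -- first term
  have h1 : |u' - u| / v' ≤ (1 / c) * (ρ * (a + 1 / 2) / a' ^ 2) := by
    rw [div_le_iff₀ hv'pos]
    calc |u' - u| ≤ T * ρ * (a + 1 / 2) := hdu
      _ = (1 / c) * (ρ * (a + 1 / 2) / a' ^ 2) * (c * T * a' ^ 2) := by field_simp
      _ ≤ (1 / c) * (ρ * (a + 1 / 2) / a' ^ 2) * v' := by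
          apply mul_le_mul_of_nonneg_left hv'
          positivity
  -- second term
  have h2 : u * |v - v'| / (v * v') ≤ (1 / c ^ 2) * (ρ * (a + 1 / 2) / a' ^ 2) := by
    rw [div_le_iff₀ (mul_pos hvpos hv'pos)]
    calc u * |v - v'| ≤ (T * a ^ 2 * ρ / 2) * (T * (2 * a + 1)) :=
          mul_le_mul hu hdv (abs_nonneg _) (by positivity)
      _ = (1 / c ^ 2) * (ρ * (a + 1 / 2) / a' ^ 2) * ((c * T * a ^ 2) * (c * T * a' ^ 2)) := by
          field_simp
      _ ≤ (1 / c ^ 2) * (ρ * (a + 1 / 2) / a' ^ 2) * (v * v') := by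
          apply mul_le_mul_of_nonneg_left (mul_le_mul hv hv' (by positivity) hvpos.le)
          positivity
  calc _ ≤ (1 / c) * (ρ * (a + 1 / 2) / a' ^ 2) + (1 / c ^ 2) * (ρ * (a + 1 / 2) / a' ^ 2) := add_le_add h1 h2
    _ = _ := by ring

/-! ## Lattice quantities: the centred representative, its `ℓ¹` norm, Jordan -/

/-- the `ℓ¹` norm of the centred representative of a momentum. [folklore] -/
def l1 (n : Tor N) : ℝ := |(n.1.valMinAbs : ℝ)| + |(n.2.valMinAbs : ℝ)|

omit [NeZero N] in
/-- `1 ≤ l1 n` for `n ≠ 0`. [folklore] -/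
theorem one_le_l1 {n : Tor N} (hn : n ≠ 0) : 1 ≤ l1 N n := by
  unfold l1
  by_contra h
  have h' := not_le.mp h
  have h1 : |(n.1.valMinAbs : ℝ)| < 1 := by linarith [abs_nonneg (n.2.valMinAbs : ℝ)]
  have h2 : |(n.2.valMinAbs : ℝ)| < 1 := by linarith [abs_nonneg (n.1.valMinAbs : ℝ)]
  have e1 : n.1.valMinAbs = 0 := by
    have : |n.1.valMinAbs| < 1 := by exact_mod_cast h1
    exact Int.abs_lt_one_iff.mp this
  have e2 : n.2.valMinAbs = 0 := by
    have : |n.2.valMinAbs| < 1 := by exact_mod_cast h2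
    exact Int.abs_lt_one_iff.mp this
  exact hn (Prod.ext ((ZMod.valMinAbs_eq_zero _).mp e1) ((ZMod.valMinAbs_eq_zero _).mp e2))

omit [NeZero N] in
/-- `l1 ≥ 0`. [folklore] -/
theorem l1_nonneg (n : Tor N) : 0 ≤ l1 N n := by unfold l1; positivity

/-- JORDAN in `ℓ¹` form: `2ε(n) ≥ (2/π²)·θ²·l1(n)²`. [folklore] -/
theorem two_epsT_ge_l1 (n : Tor N) :
    2 / Real.pi ^ 2 * (2 * Real.pi / N) ^ 2 * l1 N n ^ 2 ≤ 2 * epsT N n := by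
  have hJ := RateLemma.jordanEpsLower_holds N n
  unfold l1
  have hsq : (|(n.1.valMinAbs : ℝ)| + |(n.2.valMinAbs : ℝ)|) ^ 2
      ≤ 2 * (((n.1.valMinAbs : ℤ) : ℝ) ^ 2 + ((n.2.valMinAbs : ℤ) : ℝ) ^ 2) := by
    have := sq_abs (n.1.valMinAbs : ℝ)
    have := sq_abs (n.2.valMinAbs : ℝ)
    nlinarith [sq_nonneg (|(n.1.valMinAbs : ℝ)| - |(n.2.valMinAbs : ℝ)|), sq_abs (n.1.valMinAbs : ℝ),
      sq_abs (n.2.valMinAbs : ℝ)]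
  have hpos : 0 ≤ 2 / Real.pi ^ 2 * (2 * Real.pi / N) ^ 2 := by positivity
  nlinarith [mul_le_mul_of_nonneg_left hsq hpos]

omit [NeZero N] in
/-- the dot product `A = m₁x + m₂y` is at most `l1(n)·‖r‖` in the form `A² ≤ l1(n)²·(x² + y²)`. [folklore] -/
theorem dot_sq_le (n : Tor N) (x y : ℤ) :
    (((n.1.valMinAbs * x + n.2.valMinAbs * y : ℤ)) : ℝ) ^ 2 ≤ l1 N n ^ 2 * ((x : ℝ) ^ 2 + (y : ℝ) ^ 2) := by
  unfold l1
  push_cast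
  set a := (n.1.valMinAbs : ℝ)
  set b := (n.2.valMinAbs : ℝ)
  have hcs : (a * x + b * y) ^ 2 ≤ (a ^ 2 + b ^ 2) * ((x : ℝ) ^ 2 + (y : ℝ) ^ 2) := by
    nlinarith [sq_nonneg (a * y - b * x)]
  have hab : a ^ 2 + b ^ 2 ≤ (|a| + |b|) ^ 2 := by
    rw [add_sq, sq_abs, sq_abs]
    nlinarith [mul_nonneg (abs_nonneg a) (abs_nonneg b)]
  exact hcs.trans (mul_le_mul_of_nonneg_right hab (by positivity))

omit [NeZero N] in
/-- `|A|·|x| + x²/2 ≤ (l1(n) + ½)·(x² + y²)`. [folklore] -/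
theorem dot_mul_le (n : Tor N) (x y : ℤ) :
    |(((n.1.valMinAbs * x + n.2.valMinAbs * y : ℤ)) : ℝ)| * |(x : ℝ)| + (x : ℝ) ^ 2 / 2
      ≤ (l1 N n + 1 / 2) * ((x : ℝ) ^ 2 + (y : ℝ) ^ 2) := by
  unfold l1
  push_cast
  set a := (n.1.valMinAbs : ℝ)
  set b := (n.2.valMinAbs : ℝ)
  have h1 : |a * x + b * y| ≤ |a| * |(x : ℝ)| + |b| * |(y : ℝ)| := by
    calc |a * x + b * y| ≤ |a * x| + |b * y| := abs_add_le _ _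
      _ = |a| * |(x : ℝ)| + |b| * |(y : ℝ)| := by rw [abs_mul, abs_mul]
  have hx : |(x : ℝ)| ^ 2 = (x : ℝ) ^ 2 := sq_abs _
  have hy : |(y : ℝ)| ^ 2 = (y : ℝ) ^ 2 := sq_abs _
  have hxy : |(x : ℝ)| * |(y : ℝ)| ≤ ((x : ℝ) ^ 2 + (y : ℝ) ^ 2) / 2 := by
    nlinarith [sq_nonneg (|(x : ℝ)| - |(y : ℝ)|)]
  have k1 := mul_le_mul_of_nonneg_right h1 (abs_nonneg (x : ℝ))
  have k2 := mul_le_mul_of_nonneg_left hxy (abs_nonneg b)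
  have hxy0 : 0 ≤ (x : ℝ) ^ 2 + (y : ℝ) ^ 2 := by positivity
  have k3 : |a| * (x : ℝ) ^ 2 ≤ |a| * ((x : ℝ) ^ 2 + (y : ℝ) ^ 2) :=
    mul_le_mul_of_nonneg_left (by linarith [sq_nonneg (y : ℝ)]) (abs_nonneg a)
  have k4 : (|a| * |(x : ℝ)| + |b| * |(y : ℝ)|) * |(x : ℝ)| = |a| * (x : ℝ) ^ 2 + |b| * (|(x : ℝ)| * |(y : ℝ)|) := by
    rw [← hx]; ring
  have k5 : 0 ≤ |b| * ((x : ℝ) ^ 2 + (y : ℝ) ^ 2) := mul_nonneg (abs_nonneg b) hxy0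
  have k6 : (x : ℝ) ^ 2 / 2 ≤ ((x : ℝ) ^ 2 + (y : ℝ) ^ 2) / 2 := by linarith [sq_nonneg (y : ℝ)]
  have expand : (|a| + |b| + 1 / 2) * ((x : ℝ) ^ 2 + (y : ℝ) ^ 2)
      = |a| * ((x : ℝ) ^ 2 + (y : ℝ) ^ 2) + |b| * ((x : ℝ) ^ 2 + (y : ℝ) ^ 2) + ((x : ℝ) ^ 2 + (y : ℝ) ^ 2) / 2 := by ring
  rw [expand]
  rw [k4] at k1
  have k2' : |b| * (|(x : ℝ)| * |(y : ℝ)|) ≤ |b| * ((x : ℝ) ^ 2 + (y : ℝ) ^ 2) := by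
    refine k2.trans ?_
    have := mul_le_mul_of_nonneg_left (show ((x : ℝ) ^ 2 + (y : ℝ) ^ 2) / 2 ≤ (x : ℝ) ^ 2 + (y : ℝ) ^ 2 by linarith)
      (abs_nonneg b)
    exact this
  linarith

/-! ## The representative of `n + eₓ` -/

omit [NeZero N] in
/-- `valMinAbs (n₁ + 1) ≡ valMinAbs n₁ + 1 (mod N)`. [folklore] -/
theorem rep_succ_congr (n : Tor N) :
    ((((n + ex N).1.valMinAbs : ℤ)) : ZMod N) = (((n.1.valMinAbs + 1 : ℤ)) : ZMod N) := by
  push_cast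
  simp [ex]

/-- `| |m'₁| − |m₁| | ≤ 1` for the first coordinates of the representatives of `n` and `n + eₓ`; hence the `ℓ¹` norms differ
by at most one. [folklore] -/
theorem l1_succ_le (n : Tor N) : l1 N n ≤ l1 N (n + ex N) + 1 ∧ l1 N (n + ex N) ≤ l1 N n + 1 := by
  have hsnd : (n + ex N).2 = n.2 := by simp [ex]
  have hfst : (n + ex N).1 = n.1 + 1 := by simp [ex]
  -- |valMinAbs (n₁ + 1)| ≤ |valMinAbs n₁| + 1 and conversely
  have h1 : ((n.1 + 1).valMinAbs).natAbs ≤ n.1.valMinAbs.natAbs + 1 := by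
    have := ZMod.natAbs_valMinAbs_add_le n.1 (1 : ZMod N)
    refine this.trans ?_
    refine (Int.natAbs_add_le _ _).trans ?_
    have : ((1 : ZMod N)).valMinAbs.natAbs ≤ 1 := by
      rcases Nat.lt_or_ge N 2 with hN | hN
      · interval_cases N
        · exact absurd rfl (NeZero.ne 0)
        · decide
      · rw [show (1 : ZMod N) = ((1 : ℕ) : ZMod N) by simp, ZMod.valMinAbs_natCast_of_le_half (by omega)]
        simp
    omega
  have h2 : n.1.valMinAbs.natAbs ≤ ((n.1 + 1).valMinAbs).natAbs + 1 := by
    have := ZMod.natAbs_valMinAbs_add_le (n.1 + 1) (-1 : ZMod N)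
    rw [add_neg_cancel_right] at this
    refine this.trans ?_
    refine (Int.natAbs_add_le _ _).trans ?_
    have : ((-1 : ZMod N)).valMinAbs.natAbs ≤ 1 := by
      rw [ZMod.natAbs_valMinAbs_neg]
      rcases Nat.lt_or_ge N 2 with hN | hN
      · interval_cases N
        · exact absurd rfl (NeZero.ne 0)
        · decide
      · rw [show (1 : ZMod N) = ((1 : ℕ) : ZMod N) by simp, ZMod.valMinAbs_natCast_of_le_half (by omega)]
        simp
    omega
  unfold l1
  rw [hsnd, hfst]
  have c1 : (|(((n.1 + 1).valMinAbs : ℤ) : ℝ)|) = (((n.1 + 1).valMinAbs.natAbs : ℕ) : ℝ) := by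
    rw [Nat.cast_natAbs, Int.cast_abs]
  have c2 : (|((n.1.valMinAbs : ℤ) : ℝ)|) = ((n.1.valMinAbs.natAbs : ℕ) : ℝ) := by
    rw [Nat.cast_natAbs, Int.cast_abs]
  rw [c1, c2]
  constructor
  · have : (n.1.valMinAbs.natAbs : ℝ) ≤ ((n.1 + 1).valMinAbs.natAbs : ℝ) + 1 := by exact_mod_cast h2
    linarith
  · have : ((n.1 + 1).valMinAbs.natAbs : ℝ) ≤ (n.1.valMinAbs.natAbs : ℝ) + 1 := by exact_mod_cast h1
    linarith

end Subsample

end Summit.HubbardSuperconductivity.HubbardSuperconductivity.Theorems.AnisotropyChord.Transfer.Fibre3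

end
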